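import Literature.NumberTheory.EllipticCurves.PeriodLatticePresentationProofs
import Literature.NumberTheory.EllipticCurves.ModularCurve
import Literature.NumberTheory.EllipticCurves.ModularCurveKleinJ
import HarnessLib

/-!
# (N6) `CDivGrowth` of -an g44's `c`-DIVISION WITNESS, PROVED in the typed shape: `F = ℘_{Λ_W}(ℰ_f)·(12·B_d·Δ^a)` is
# BOUNDED at every cusp for `a` large along a coset cover of the finite-index stabiliser
(route `ManinLocalTwoThree`, cruxes C2 stmt-BirchSwinnertonDyer-22967 / C3 stmt-BirchSwinnertonDyer-22968; cell bsd-f2-manin, prover p3 gen 18)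

Port of the Literature template `isZeroAtImInfty_slash_of_presentation` (`PeriodLatticePresentationProofs`): coset representatives `R` of the
finite-index `Γ ≤ Γ₀(N)` (`exists_finset_mul_cover`), `a := 2 + Σ_{r ∈ R} (2m_r + 1)` with `m_r` the order at `q_N = 0` of `V_{f∣r} = 2πi∫(f∣[2]r)`,
`ℰ_f(r·τ) = C_r + V_{f∣r}(τ)` (`exists_eichlerIntegral_smul_eq`), `℘_{Λ_W}(C_r + V_{f∣r})·Δ^a → 0` at `i∞`
(`IsCuspFunction.tendsto_weierstrassP_mul_pow_atImInfty`, `isCuspFunction_discriminant`), `B_d ∣[w] r` bounded (`ModularFormClass.bdd_at_infty_slash`),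
`F ∣ (γr) = F ∣ r` for `γ ∈ Γ`, and `(F ∣[w+12a] r)(τ) = ℘_{Λ_W}(C_r + V_{f∣r}(τ))·Δ(τ)^a·12·(B_d ∣[w] r)(τ)` for `Im τ ≥ T_r`
(`exists_forall_eichlerIntegral_smul_notMem`, `discriminant_apply_smul`).  Growth exponent `m = 0`.
* `cDivGrowth_uniform` — the exponent `a` is chosen from `Γ` alone (before the weight and `B_d`), as the assembly needs;
* `cDivGrowth` — **(N6) in -an's typed shape** (`HOME/an/g44/CDivisionWitnessNodes-an-g44.lean` §5, def `CDivision.CDivGrowth`, verbatim body).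
HONEST FRAMING: one node of seven; the witness law, C2/C3, Manin's conjecture and BSD are NOT proved here.  No definitions, no sorry.
[cite: ShimuraIATAF1971, §2.4, Thm. 7.14] [folklore]
-/

set_option autoImplicit false

noncomputable section

open Complex Filter Topology Set Function
open UpperHalfPlane hiding I
open scoped Real Topology Manifold MatrixGroups PeriodPair ModularForm
open ModularForm CongruenceSubgroup
open Literature.NumberTheory.EllipticCurves Literature.NumberTheory.EllipticCurves.ModularForms

-- lint-debt: the directory name repeats the summit name (sibling precedent `ManinLocalTwoThreeCDivisionCuspGerm.lean`)
set_option linter.dupNamespace false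

namespace Summit.BirchSwinnertonDyer.BirchSwinnertonDyer.Theorems.ManinLocalTwoThree.CDivGrowth

/-- **(N6), uniform form: the exponent depends on the group only.**  For a finite-index `Γ ≤ Γ₀(N)` there is `a ≥ 2` such that for EVERY
weight `w`, every `B_d ∈ M_w(Γ₀(N))` and every `Γ`-invariant `F` of weight `w + 12a` equal to `℘_{Λ_W}(ℰ_f)·(12·B_d·Δ^a)` off the poles,
`‖(F ∣[w+12a] g)(τ)‖ ≤ C` high in every cusp `g·i∞` (growth exponent `0`; `a = 2 + Σ_{r ∈ R}(2m_r + 1)` over coset representatives `R`).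
[cite: ShimuraIATAF1971, §2.4, Thm. 7.14] [folklore] -/
theorem cDivGrowth_uniform (W : WeierstrassCurve ℚ) [W.IsElliptic] [W.IsGloballyMinimal] {N : ℕ} [NeZero N]
    (D : ModularParametrizationData W N) (Γ : Subgroup SL(2, ℤ)) (_hle : Γ ≤ Gamma0 N) (hfi : Γ.FiniteIndex) :
    ∃ a : ℕ, 2 ≤ a ∧ ∀ (w : ℤ) (Bd : ModularForm (Gamma0 N) w) (F : ℍ → ℂ), (∀ γ ∈ Γ, F ∣[w + 12 * (a : ℤ)] γ = F) →
      (∀ τ : ℍ, eichlerIntegral D.f τ ∉ D.L.lattice →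
        F τ = ℘[D.L] (eichlerIntegral D.f τ) * ((12 : ℂ) * Bd τ * ModularForm.discriminant τ ^ a)) →
      ∀ g : SL(2, ℤ), ∃ C A m : ℝ, ∀ τ : ℍ, A ≤ τ.im → ‖(F ∣[w + 12 * (a : ℤ)] g) τ‖ ≤ C * Real.exp (m * τ.im) := by
  classical
  haveI := hfi
  have hf : D.f ≠ 0 := D.isNewformOf.1.ne_zero
  obtain ⟨R, hR⟩ := exists_finset_mul_cover Γ
  set m : SL(2, ℤ) → ℕ := fun r ↦ analyticOrderNatAt (cuspFunction N (verticalIntegral (⇑D.f ∣[(2 : ℤ)] r))) 0 with hm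
  set a : ℕ := 2 + ∑ r ∈ R, (2 * m r + 1) with ha
  have haR : ∀ r ∈ R, 2 * m r + 1 ≤ a := fun r hr ↦
    (Finset.single_le_sum (f := fun r ↦ 2 * m r + 1) (fun _ _ ↦ Nat.zero_le _) hr).trans (Nat.le_add_left _ _)
  refine ⟨a, Nat.le_add_right _ _, fun w Bd F hFinv hFeq g ↦ ?_⟩
  obtain ⟨γ, hγ, r, hr, hg⟩ := hR g
  -- `F ∣ g = F ∣ r`
  have hslash : F ∣[w + 12 * (a : ℤ)] g = F ∣[w + 12 * (a : ℤ)] r := by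
    rw [hg, SlashAction.slash_mul, hFinv γ hγ]
  -- the cusp `r·i∞`
  obtain ⟨C, hC⟩ := exists_eichlerIntegral_smul_eq D.f r
  obtain ⟨T, hT⟩ := exists_forall_eichlerIntegral_smul_notMem D.f hf D.L r
  have hlim := (isCuspFunction_verticalIntegral_slash D.f r).tendsto_weierstrassP_mul_pow_atImInfty
    (verticalIntegral_slash_ne_zero D.f hf r) isCuspFunction_discriminant D.L C (haR r hr)
  have hev : ∀ᶠ τ : ℍ in atImInfty,
      ‖℘[D.L] (C + verticalIntegral (⇑D.f ∣[(2 : ℤ)] r) τ) * ModularForm.discriminant τ ^ a‖ < 1 := by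
    have h := (Metric.tendsto_nhds.mp hlim) 1 one_pos
    filter_upwards [h] with τ hτ
    rwa [dist_zero_right] at hτ
  obtain ⟨A₁, hA₁⟩ := (atImInfty_mem _).mp hev
  obtain ⟨M, A₂, hM⟩ := UpperHalfPlane.isBoundedAtImInfty_iff.mp (ModularFormClass.bdd_at_infty_slash Bd r)
  refine ⟨12 * M, max T (max A₁ A₂), 0, fun τ hτ ↦ ?_⟩
  have hTτ : T ≤ τ.im := (le_max_left _ _).trans hτ
  have hA₁τ : A₁ ≤ τ.im := (le_max_left _ _).trans ((le_max_right _ _).trans hτ)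
  have hA₂τ : A₂ ≤ τ.im := (le_max_right _ _).trans ((le_max_right _ _).trans hτ)
  have hd : denom (r : SL(2, ℤ)) τ ≠ 0 := denom_ne_zero _ τ
  -- the value of `F ∣ r` high in the cusp
  have hval : (F ∣[w + 12 * (a : ℤ)] r) τ =
      ℘[D.L] (C + verticalIntegral (⇑D.f ∣[(2 : ℤ)] r) τ) * ModularForm.discriminant τ ^ a *
        ((12 : ℂ) * (⇑Bd ∣[w] r) τ) := by
    rw [ModularForm.SL_slash_apply, ModularForm.SL_slash_apply, hFeq (r • τ) (hT τ hTτ), hC τ, discriminant_apply_smul r τ,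
      mul_pow, ← zpow_natCast, ← zpow_mul, neg_add, zpow_add₀ hd, zpow_neg, zpow_neg]
    field_simp
  rw [hslash, hval]
  have h1 : ‖℘[D.L] (C + verticalIntegral (⇑D.f ∣[(2 : ℤ)] r) τ) * ModularForm.discriminant τ ^ a‖ ≤ 1 := (hA₁ τ hA₁τ).le
  have h2 : ‖(12 : ℂ) * (⇑Bd ∣[w] r) τ‖ ≤ 12 * M := by
    rw [norm_mul, Complex.norm_ofNat]
    exact mul_le_mul_of_nonneg_left (hM τ hA₂τ) (by norm_num)
  calc ‖℘[D.L] (C + verticalIntegral (⇑D.f ∣[(2 : ℤ)] r) τ) * ModularForm.discriminant τ ^ a * ((12 : ℂ) * (⇑Bd ∣[w] r) τ)‖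
      = ‖℘[D.L] (C + verticalIntegral (⇑D.f ∣[(2 : ℤ)] r) τ) * ModularForm.discriminant τ ^ a‖ * ‖(12 : ℂ) * (⇑Bd ∣[w] r) τ‖ :=
        norm_mul _ _
    _ ≤ 1 * (12 * M) := mul_le_mul h1 h2 (norm_nonneg _) zero_le_one
    _ = 12 * M * Real.exp (0 * τ.im) := by rw [zero_mul, Real.exp_zero, mul_one, one_mul]


/-- **(N6) `CDivGrowth` — PROVED.**  For a finite-index `Γ ≤ Γ₀(N)` there is `a ≥ 2` such that every `Γ`-invariant `F` of weight `w + 12a`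
which equals `℘_{Λ_W}(ℰ_f)·(12·B_d·Δ^a)` off the poles satisfies `‖(F ∣[w+12a] g)(τ)‖ ≤ C` high in every cusp `g·i∞` (growth exponent `0`).
Verbatim the body of -an g44's typed node `CDivision.CDivGrowth`. [cite: ShimuraIATAF1971, §2.4, Thm. 7.14] [folklore] -/
theorem cDivGrowth : ∀ (W : WeierstrassCurve ℚ) [W.IsElliptic] [W.IsGloballyMinimal] {N : ℕ} [NeZero N]
    (D : ModularParametrizationData W N) (w : ℤ) (Bd : ModularForm (Gamma0 N) w) (Γ : Subgroup SL(2, ℤ)),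
    Γ ≤ Gamma0 N → Γ.FiniteIndex →
    ∃ a : ℕ, 2 ≤ a ∧ ∀ F : ℍ → ℂ, (∀ γ ∈ Γ, F ∣[w + 12 * (a : ℤ)] γ = F) →
      (∀ τ : ℍ, eichlerIntegral D.f τ ∉ D.L.lattice →
        F τ = ℘[D.L] (eichlerIntegral D.f τ) * ((12 : ℂ) * Bd τ * ModularForm.discriminant τ ^ a)) →
      ∀ g : SL(2, ℤ), ∃ C A m : ℝ, ∀ τ : ℍ, A ≤ τ.im → ‖(F ∣[w + 12 * (a : ℤ)] g) τ‖ ≤ C * Real.exp (m * τ.im) := by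
  intro W _ _ N _ D w Bd Γ hle hfi
  obtain ⟨a, ha, h⟩ := cDivGrowth_uniform W D Γ hle hfi
  exact ⟨a, ha, fun F hFinv hFeq g ↦ h w Bd F hFinv hFeq g⟩

end Summit.BirchSwinnertonDyer.BirchSwinnertonDyer.Theorems.ManinLocalTwoThree.CDivGrowth

end
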